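import Summits.FinalStateConjecture.FinalStateConjecture.Theorems.ParametricKerrBurial.Negative.ZeroSpinShieldCurvature
import Literature.Geometry.Lorentzian.CoordFamilyRegularity
import Literature.Geometry.Lorentzian.ChartMetricCoord

/-!
# Negative lemmas for the crux `SwallowTheDatum.ParametricKerrBurial`, II — the `c → 0` limit:
# zero-spin burial families must swell or recede

Support file (refuter, cdisprove seat of `stmt-FinalStateConjecture-10052`; everything proved,
no definitions, no named facts), continuing `ZeroSpinShieldCurvature.lean`. The typed genericity
`InitialDataSet.IsSmoothDataFamily` is LOCAL joint smoothness on `ℝ¹ × X`; along a family through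
flat data the scalar curvature is therefore jointly continuous, which pins down WHERE the
Kerr-shielded members of a burial family can keep their horizons:

* `contDiffAt_repr_of_isSmoothDataFamily` — `IsSmoothDataFamily 1 F` on a chart domain unpacked:
  representatives of `h_c` are jointly `C^∞` in `(c, y)` (`contMDiffAt_bilin_iff` in the identity
  trivialisation, composed with a local inverse of `Subtype.val`);
* `isMetricFamilyOn_of_isSmoothDataFamily`, `continuous_scalarCurvature_family` — along a smooth
  family of data on `ℝ³` the scalar curvature is jointly continuous in `(point, parameter)` (the
  Ricci-flow brick `MetricCoord.IsMetricFamilyOn.contDiffOn_scalAt_family` and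
  `OpensChart.scalarCurvature_eq_scalAt`);
* `false_of_scalarCurvature_ge_on_compact` and the CONFINED STRENGTHENING REFUTED,
  `not_confined_zeroSpin_burial_of_radius_le`: a smooth family through `trivialData` cannot carry,
  along `cₙ → 0`, zero-spin shields with bounded junction radii (a fortiori bounded masses,
  `r₁ < 2M`) whose near-junction zones `φₙ({‖y‖ < 4Mₙ})` stay in one compact set — the junction
  spheres of a burial family must swell or recede to infinity: the typed genericity is escaped only
  at infinity (route kill criterion (e), quantified).

## References

* D. Christodoulou, CQG 16 (1999) A23, p. A24 (families of data). [Christodoulou1999]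
* P. Topping, *Lectures on the Ricci flow* (2006), §1.2.3. [Topping2006]
* B. O'Neill, *Semi-Riemannian geometry* (1983), Ch. 3, Def. 3.53. [ONeill1983]
-/

noncomputable section

-- instance search through nested operator types (as in the tree files)
set_option maxSynthPendingDepth 3

namespace Summit.FinalStateConjecture.FinalStateConjecture.Theorems.ParametricKerrBurial.Negative

open Literature.Geometry.Lorentzian
open scoped Manifold ContDiff Topology InnerProductSpace
open Set Bundle Filter

/-! ### Smooth families of data on a chart domain: the scalar curvature is jointly continuous -/

/-- Every `c ∈ ℝ¹` is `c 0 • e₁`. [folklore] -/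
theorem eq_smul_single (c : EuclideanSpace ℝ (Fin 1)) :
    c = c 0 • EuclideanSpace.single (0 : Fin 1) (1 : ℝ) := by
  ext i
  fin_cases i
  simp

/-- **Bridge from bundle smoothness to calculus**: along a smooth one-parameter family of data on
a chart domain `U ⊆ E3` (`InitialDataSet.IsSmoothDataFamily 1 F`), any representative `G c` of
`h_c` is jointly `C^∞` in `(c, y)` (the smoothness criterion `contMDiffAt_bilin_iff` in the
identity trivialisation of `TU`, composed with a local inverse of `Subtype.val`).
[cite: Christodoulou1999, p. A24] -/
theorem contDiffAt_repr_of_isSmoothDataFamily {U : TopologicalSpace.Opens E3}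
    {F : EuclideanSpace ℝ (Fin 1) → InitialDataSet 𝓘(ℝ, E3) U}
    (hF : InitialDataSet.IsSmoothDataFamily 1 F)
    {G : EuclideanSpace ℝ (Fin 1) → E3 → E3 →L[ℝ] E3 →L[ℝ] ℝ}
    (hG : ∀ c (y : U), (F c).h.inner y = G c y) (c₀ : EuclideanSpace ℝ (Fin 1)) (y₀ : U) :
    ContDiffAt ℝ ∞ (Function.uncurry G) (c₀, (y₀ : E3)) := by
  classical
  have h1 := hF.1 (c₀, y₀)
  rw [contMDiffAt_bilin_iff] at h1
  obtain ⟨-, h2⟩ := h1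
  have hsymm : ∀ (z : U) (v : E3),
      (trivializationAt E3 (TangentSpace 𝓘(ℝ, E3) : U → Type _) y₀).symmL ℝ z v = v := by
    intro z v
    rw [Trivialization.symmL_apply _ (by simp [OpensChart.chartAt_source])]
    exact OpensChart.trivializationAt_symm_apply y₀ z v
  have hfun : (fun x : EuclideanSpace ℝ (Fin 1) × U ↦ (ContinuousLinearMap.precomp ℝ
      ((trivializationAt E3 (TangentSpace 𝓘(ℝ, E3) : U → Type _) y₀).symmL ℝ x.2)).comp
        (((F x.1).h.inner x.2).comp
          ((trivializationAt E3 (TangentSpace 𝓘(ℝ, E3) : U → Type _) y₀).symmL ℝ x.2))) =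
      fun x ↦ G x.1 x.2 := by
    funext x
    ext v w
    simp only [ContinuousLinearMap.comp_apply, ContinuousLinearMap.precomp_apply, hsymm, hG]
    rfl
  rw [hfun] at h2
  set σ : E3 → U := fun z ↦ if hz : z ∈ U then ⟨z, hz⟩ else y₀ with hσdef
  have hσval : ∀ z ∈ (U : Set E3), (σ z : E3) = z := fun z hz ↦ by
    have hz' : z ∈ U := hz
    simp only [hσdef]
    rw [dif_pos hz']
  have hσy₀ : σ y₀ = y₀ := by
    simp only [hσdef]
    rw [dif_pos y₀.2]
  have hUo : IsOpen ((Set.univ : Set (EuclideanSpace ℝ (Fin 1))) ×ˢ (U : Set E3)) :=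
    isOpen_univ.prod U.2
  have hmem : (c₀, (y₀ : E3)) ∈ (Set.univ : Set (EuclideanSpace ℝ (Fin 1))) ×ˢ (U : Set E3) :=
    ⟨trivial, y₀.2⟩
  have hj2 : ContMDiffAt 𝓘(ℝ, EuclideanSpace ℝ (Fin 1) × E3) 𝓘(ℝ, E3) ∞
      (fun q : EuclideanSpace ℝ (Fin 1) × E3 ↦ σ q.2) (c₀, (y₀ : E3)) := by
    rw [← ContMDiffAt.subtypeVal_comp_iff]
    have hev : (Subtype.val ∘ fun q : EuclideanSpace ℝ (Fin 1) × E3 ↦ σ q.2) =ᶠ[𝓝 (c₀, (y₀ : E3))]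
        Prod.snd := by
      filter_upwards [hUo.mem_nhds hmem] with q hq
      exact hσval q.2 hq.2
    exact contDiff_snd.contMDiff.contMDiffAt.congr_of_eventuallyEq hev
  have hj : ContMDiffAt 𝓘(ℝ, EuclideanSpace ℝ (Fin 1) × E3)
      (𝓘(ℝ, EuclideanSpace ℝ (Fin 1)).prod 𝓘(ℝ, E3)) ∞
      (fun q : EuclideanSpace ℝ (Fin 1) × E3 ↦ (q.1, σ q.2)) (c₀, (y₀ : E3)) :=
    contDiff_fst.contMDiff.contMDiffAt.prodMk hj2
  have hcomp : ContMDiffAt 𝓘(ℝ, EuclideanSpace ℝ (Fin 1) × E3) 𝓘(ℝ, E3 →L[ℝ] E3 →L[ℝ] ℝ) ∞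
      ((fun x : EuclideanSpace ℝ (Fin 1) × U ↦ G x.1 x.2) ∘
        fun q : EuclideanSpace ℝ (Fin 1) × E3 ↦ (q.1, σ q.2)) (c₀, (y₀ : E3)) :=
    ContMDiffAt.comp_of_eq h2 hj (Prod.ext rfl hσy₀)
  have hev2 : Function.uncurry G =ᶠ[𝓝 (c₀, (y₀ : E3))]
      ((fun x : EuclideanSpace ℝ (Fin 1) × U ↦ G x.1 x.2) ∘
        fun q : EuclideanSpace ℝ (Fin 1) × E3 ↦ (q.1, σ q.2)) := by
    filter_upwards [hUo.mem_nhds hmem] with q hq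
    simp only [Function.comp_apply, Function.uncurry, hσval q.2 hq.2]
  exact contMDiffAt_iff_contDiffAt.1 (hcomp.congr_of_eventuallyEq hev2)

/-- **A smooth family of data on a chart domain is a smooth metric family in coordinates**
(`MetricCoord.IsMetricFamilyOn` along the line `t ↦ t e₁`). [cite: Topping2006, §1.2.3] -/
theorem isMetricFamilyOn_of_isSmoothDataFamily {U : TopologicalSpace.Opens E3}
    {F : EuclideanSpace ℝ (Fin 1) → InitialDataSet 𝓘(ℝ, E3) U}
    (hF : InitialDataSet.IsSmoothDataFamily 1 F)
    {G : EuclideanSpace ℝ (Fin 1) → E3 → E3 →L[ℝ] E3 →L[ℝ] ℝ}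
    (hG : ∀ c (y : U), (F c).h.inner y = G c y) :
    MetricCoord.IsMetricFamilyOn
      (fun t : ℝ ↦ G (t • EuclideanSpace.single (0 : Fin 1) (1 : ℝ))) Set.univ (U : Set E3) where
  isMetricOn t _ :=
    OpensChart.isMetricOn_repr (g := (F (t • EuclideanSpace.single (0 : Fin 1) (1 : ℝ))).metric)
      (G := G (t • EuclideanSpace.single (0 : Fin 1) (1 : ℝ))) fun y ↦ by
      rw [InitialDataSet.val_metric]; exact hG _ y
  contDiffOn := by
    rintro p ⟨hp, -⟩
    have hA := contDiffAt_repr_of_isSmoothDataFamily hF hG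
      (p.2 • EuclideanSpace.single (0 : Fin 1) (1 : ℝ)) ⟨p.1, hp⟩
    have hB : ContDiffAt ℝ ∞
        (fun q : E3 × ℝ ↦ (q.2 • EuclideanSpace.single (0 : Fin 1) (1 : ℝ), q.1)) p :=
      ((contDiff_snd.smul contDiff_const).prodMk contDiff_fst).contDiffAt
    exact (hA.comp p hB).contDiffWithinAt
  uniqueDiffOn := uniqueDiffOn_univ
  subset_closure_interior := by simp

/-- **The scalar curvature is jointly continuous along a smooth family of data on `ℝ³`**:
`(z, t) ↦ R(h_{t e₁})(z)` is continuous on `E3 × ℝ` (data on `Minkowski.slice = ⊤`; each member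
with its canonical Levi-Civita instance `PseudoRiemannianMetric.hasLeviCivita`).
[cite: Topping2006, §1.2.3] [cite: ONeill1983, Ch. 3, Def. 3.53] -/
theorem continuous_scalarCurvature_family
    {F : EuclideanSpace ℝ (Fin 1) → InitialDataSet 𝓘(ℝ, E3) Minkowski.slice}
    (hF : InitialDataSet.IsSmoothDataFamily 1 F) :
    Continuous fun q : E3 × ℝ ↦
      haveI := (F (q.2 • EuclideanSpace.single (0 : Fin 1) (1 : ℝ))).metric.hasLeviCivita
      (F (q.2 • EuclideanSpace.single (0 : Fin 1) (1 : ℝ))).metric.scalarCurvature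
        ⟨q.1, Minkowski.mem_slice q.1⟩ := by
  set G : EuclideanSpace ℝ (Fin 1) → E3 → E3 →L[ℝ] E3 →L[ℝ] ℝ :=
    fun c z ↦ (F c).h.inner ⟨z, Minkowski.mem_slice z⟩ with hGdef
  have hG : ∀ c (y : Minkowski.slice), (F c).h.inner y = G c y := fun c y ↦ rfl
  have hfam := isMetricFamilyOn_of_isSmoothDataFamily hF hG
  have hcont : Continuous fun q : E3 × ℝ ↦
      MetricCoord.scalAt (G (q.2 • EuclideanSpace.single (0 : Fin 1) (1 : ℝ))) q.1 := by
    have h := hfam.contDiffOn_scalAt_family.continuousOn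
    have huniv : ((Minkowski.slice : TopologicalSpace.Opens E3) : Set E3) ×ˢ (Set.univ : Set ℝ) =
        Set.univ := by
      ext q; simp [Minkowski.mem_slice]
    rw [huniv] at h
    exact continuousOn_univ.1 h
  refine hcont.congr fun q ↦ ?_
  haveI := (F (q.2 • EuclideanSpace.single (0 : Fin 1) (1 : ℝ))).metric.hasLeviCivita
  exact (OpensChart.scalarCurvature_eq_scalAt
    (g := (F (q.2 • EuclideanSpace.single (0 : Fin 1) (1 : ℝ))).metric)
    (G := G (q.2 • EuclideanSpace.single (0 : Fin 1) (1 : ℝ)))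
    (fun y ↦ by rw [InitialDataSet.val_metric]) ⟨q.1, Minkowski.mem_slice q.1⟩).symm

/-- Reparametrisation `c = c 0 • e₁` inside the curvature functional of a family (stated so that
no rewriting under the Levi-Civita instance is needed downstream). [folklore] -/
theorem scalarCurvature_family_param
    (F : EuclideanSpace ℝ (Fin 1) → InitialDataSet (𝓡 3) Minkowski.slice)
    (c : EuclideanSpace ℝ (Fin 1)) (y : Minkowski.slice) :
    (fun q : E3 × ℝ ↦
      haveI := (F (q.2 • EuclideanSpace.single (0 : Fin 1) (1 : ℝ))).metric.hasLeviCivita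
      (F (q.2 • EuclideanSpace.single (0 : Fin 1) (1 : ℝ))).metric.scalarCurvature
        ⟨q.1, Minkowski.mem_slice q.1⟩) ((y : E3), c 0) =
    (haveI := (F c).metric.hasLeviCivita; (F c).metric.scalarCurvature y) := by
  have key : ∀ c' : EuclideanSpace ℝ (Fin 1), c' = c →
      (haveI := (F c').metric.hasLeviCivita;
        (F c').metric.scalarCurvature ⟨(y : E3), Minkowski.mem_slice (y : E3)⟩) =
      (haveI := (F c).metric.hasLeviCivita; (F c).metric.scalarCurvature y) := by
    rintro c' rfl
    rfl
  exact key _ (eq_smul_single c).symm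

/-- At the parameter `0` the curvature functional of a family through `trivialData` vanishes
(`R(δ) = 0`, `trivialData_scalarCurvature_eq_zero`). [folklore] -/
theorem scalarCurvature_family_zero
    {F : EuclideanSpace ℝ (Fin 1) → InitialDataSet (𝓡 3) Minkowski.slice}
    (h0 : F 0 = trivialData) (y : Minkowski.slice) :
    (fun q : E3 × ℝ ↦
      haveI := (F (q.2 • EuclideanSpace.single (0 : Fin 1) (1 : ℝ))).metric.hasLeviCivita
      (F (q.2 • EuclideanSpace.single (0 : Fin 1) (1 : ℝ))).metric.scalarCurvature
        ⟨q.1, Minkowski.mem_slice q.1⟩) ((y : E3), (0 : ℝ)) = 0 := by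
  have key : ∀ D : InitialDataSet (𝓡 3) Minkowski.slice, D = trivialData →
      (haveI := D.metric.hasLeviCivita;
        D.metric.scalarCurvature ⟨(y : E3), Minkowski.mem_slice (y : E3)⟩) = 0 := by
    rintro D rfl
    haveI := trivialData.metric.hasLeviCivita
    exact trivialData_scalarCurvature_eq_zero _
  refine key _ ?_
  rw [← h0]
  congr 1
  exact zero_smul _ _

/-- **Core of the `c → 0` argument**: along a smooth family through flat data, no sequence of
members `F cₙ`, `cₙ → 0`, can have points `xₙ` in ONE compact set with scalar curvature bounded
below by a positive constant (`R(δ) = 0` and joint continuity). [cite: Christodoulou1999, p. A24] -/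
theorem false_of_scalarCurvature_ge_on_compact
    {F : EuclideanSpace ℝ (Fin 1) → InitialDataSet (𝓡 3) Minkowski.slice}
    (hF : InitialDataSet.IsSmoothDataFamily 1 F) (h0 : F 0 = trivialData)
    {c : ℕ → EuclideanSpace ℝ (Fin 1)} (hc : Tendsto c atTop (𝓝 0))
    {C : Set Minkowski.slice} (hC : IsCompact C) {κ : ℝ} (hκ : 0 < κ)
    {x : ℕ → Minkowski.slice} (hxC : ∀ n, x n ∈ C)
    (hxR : ∀ n, ∀ [(F (c n)).metric.HasLeviCivita], κ ≤ (F (c n)).metric.scalarCurvature (x n)) :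
    False := by
  set Rf : E3 × ℝ → ℝ := fun q ↦
    haveI := (F (q.2 • EuclideanSpace.single (0 : Fin 1) (1 : ℝ))).metric.hasLeviCivita
    (F (q.2 • EuclideanSpace.single (0 : Fin 1) (1 : ℝ))).metric.scalarCurvature
      ⟨q.1, Minkowski.mem_slice q.1⟩ with hRf
  have hRc : Continuous Rf := continuous_scalarCurvature_family hF
  have hlow : ∀ n, κ ≤ Rf ((x n : E3), c n 0) := by
    intro n
    have e1 : Rf ((x n : E3), c n 0) =
        (haveI := (F (c n)).metric.hasLeviCivita; (F (c n)).metric.scalarCurvature (x n)) :=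
      scalarCurvature_family_param F (c n) (x n)
    rw [e1]
    exact @hxR n (F (c n)).metric.hasLeviCivita
  obtain ⟨xs, hxs, κ', hκ', hlim⟩ := hC.tendsto_subseq hxC
  have hlim' : Tendsto (fun k ↦ ((x (κ' k) : E3), c (κ' k) 0)) atTop (𝓝 ((xs : E3), 0)) := by
    refine Tendsto.prodMk_nhds ?_ ?_
    · exact (continuous_subtype_val.tendsto xs).comp hlim
    · have h0c : Tendsto (fun n ↦ c n 0) atTop (𝓝 ((0 : EuclideanSpace ℝ (Fin 1)) 0)) :=
        ((EuclideanSpace.proj (0 : Fin 1)).continuous.tendsto (0 : EuclideanSpace ℝ (Fin 1))).comp hc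
      exact h0c.comp hκ'.tendsto_atTop
  have hRlim : Tendsto (fun k ↦ Rf ((x (κ' k) : E3), c (κ' k) 0)) atTop (𝓝 (Rf ((xs : E3), 0))) :=
    (hRc.tendsto _).comp hlim'
  have hR0 : Rf ((xs : E3), 0) = 0 := scalarCurvature_family_zero h0 xs
  rw [hR0] at hRlim
  have hge : κ ≤ 0 := ge_of_tendsto hRlim (Eventually.of_forall fun k ↦ hlow (κ' k))
  exact absurd hge (not_le.2 hκ)

/-- **Zero-spin burial families must swell or recede** (a CONFINED strengthening of the crux
`ParametricKerrBurial` refuted at flat data). Let `F` be a smooth one-parameter family of data on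
`ℝ³` with `F 0 = trivialData` and `cₙ → 0`. Suppose each `F cₙ` carries a zero-spin shield —
mass `Mₙ > 0`, junction radius `0 < r₁(n) < r₊`, a height `Tₙ` vanishing on `r ≤ 4Mₙ` (e.g. the
crux's bent height, `crux_height_eq_zero`), a smooth `φₙ : slice 0 r₁(n) → ℝ³` and the graph `ψₙ`
with `φₙ^* h = ψₙ^* g_{Mₙ,0}` — with BOUNDED junction radii `r₁(n) ≤ ρ` and near-junction zones
`φₙ({‖y‖ < 4Mₙ})` inside ONE compact set `C`. Then `False`. (Only the `h`-clauses of the shielding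
predicate are used; bounded masses imply bounded junction radii since `r₁ < 2M`.)
[cite: Christodoulou1999, p. A24] [cite: Cook2000, §3.2.2 (55)–(57)] -/
theorem not_confined_zeroSpin_burial_of_radius_le [Kerr.Facts]
    {F : EuclideanSpace ℝ (Fin 1) → InitialDataSet (𝓡 3) Minkowski.slice}
    (hF : InitialDataSet.IsSmoothDataFamily 1 F) (h0 : F 0 = trivialData)
    {c : ℕ → EuclideanSpace ℝ (Fin 1)} (hc : Tendsto c atTop (𝓝 0)) {M r₁ : ℕ → ℝ}
    {C : Set Minkowski.slice} (hC : IsCompact C) {ρ : ℝ} (hρ : ∀ n, r₁ n ≤ ρ)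
    (hS : ∀ n, ∃ (T : ℝ → ℝ) (φ : Kerr.slice 0 (r₁ n) → Minkowski.slice)
      (ψ : Kerr.slice 0 (r₁ n) → Kerr.region 0 (r₁ n)),
      0 < M n ∧ 0 < r₁ n ∧ r₁ n < Kerr.rPlus (M n) 0 ∧ (∀ r, r ≤ 4 * M n → T r = 0) ∧
      ContMDiff 𝓘(ℝ, E3) (𝓡 3) ∞ φ ∧
      (∀ y : Kerr.slice 0 (r₁ n), (ψ y : E4) =
        E4.ofTimeSpace (T (Kerr.radius 0 (E4.ofTimeSpace 0 (y : E3)))) (y : E3)) ∧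
      (∀ y : Kerr.slice 0 (r₁ n),
        pullbackBilin (I := 𝓡 3) (I' := 𝓘(ℝ, E3)) φ (F (c n)).h.inner y =
          pullbackBilin (I := 𝓘(ℝ, E4)) (I' := 𝓘(ℝ, E3)) ψ (Kerr.smoothMetric (M n) 0 (r₁ n)).val y) ∧
      (∀ y : Kerr.slice 0 (r₁ n), ‖(y : E3)‖ < 4 * M n → φ y ∈ C)) : False := by
  have hρpos : 0 < ρ + 1 := by
    obtain ⟨-, -, -, -, hr, -⟩ := hS 0
    linarith [hρ 0]
  have hx : ∀ n, ∃ x ∈ C, ∀ [(F (c n)).metric.HasLeviCivita],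
      1 / (2 * (ρ + 1) ^ 2) ≤ (F (c n)).metric.scalarCurvature x := by
    intro n
    obtain ⟨T, φ, ψ, hMpos, hr₁pos, hr₁, hT0, hφ, hψ, hh, hCn⟩ := hS n
    haveI := (F (c n)).metric.hasLeviCivita
    obtain ⟨y, hy4, hR⟩ :=
      exists_scalarCurvature_ge_of_zeroSpinShield (F (c n)) hMpos hr₁pos hr₁ hT0 hφ hψ hh
    refine ⟨φ y, hCn y hy4, ?_⟩
    intro inst
    have hR' : 1 / (2 * (r₁ n + 1) ^ 2) ≤ (F (c n)).metric.scalarCurvature (φ y) := hR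
    refine le_trans ?_ hR'
    have h4 : 0 < 2 * (r₁ n + 1) ^ 2 := by positivity
    exact div_le_div_of_nonneg_left zero_le_one h4 (by nlinarith [hρ n])
  choose x hxC hxR using hx
  exact false_of_scalarCurvature_ge_on_compact hF h0 hc hC (by positivity) hxC hxR

end Summit.FinalStateConjecture.FinalStateConjecture.Theorems.ParametricKerrBurial.Negative

end
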